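import Literature.NumberTheory.GaloisRepresentations.AbsGaloisOuterConj
import Literature.NumberTheory.GaloisRepresentations.LocalWeilDatum
import HarnessLib

/-!
# Transport of the absolute Galois group along an ARBITRARY identification of algebraic closures:
# `e : M̄ → F̄` (over `F`) induces an injective `c_e : Γ_M →* Γ_F` with `e (σ z) = c_e(σ) (e z)`, image `Gal(F̄/e(M))`

Topic `Literature/NumberTheory/GaloisRepresentations` (companion of `AbsGaloisGroup`, `AbsGaloisOuterConj`).
THEOREMS ONLY (no definition, no named fact, no instance, no `sorry`).

For an algebraic extension `M/F` the tree fixes ONE `F`-embedding `ι : F̄ → M̄` (`absClosureEmbedding F M`, an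
isomorphism `absClosureEquiv F M`) and the restriction `res : Γ_M → Γ_F` along it (`absGaloisRestrict F M`,
`ι (res σ • x) = σ • ι x`).  Arithmetic statements, however, often DISPLAY an arbitrary identification
`e : M̄ →ₐ[F] F̄` in the other direction (e.g. the binder `e : K̄ →+* ℚ̄` of the (B2′) road of the BSD cell
`bsd-cm`).  Milne (FT §7, footnote to the definition of the absolute Galois group): any two identifications
differ by an inner automorphism.  Here, in existence form (so that consumers `obtain` the homomorphism):

* §1 `exists_transportHom` — there is a group homomorphism `c : Γ_M →* Γ_F` with
  (i) `e (σ • z) = c σ • e z` for all `σ, z` (equivariance), (ii) `c` injective, (iii) `e` bijective,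
  (iv) `g ∈ range c ↔ g` fixes `e(M)` pointwise (`res(Γ_M) = Gal(F̄/e(M))`,
  `mem_range_absGaloisRestrict_iff_smul_absEmbedding`, conjugated).  Construction: `c = Inn(g₀) ∘ res` with
  `g₀ = e ∘ ι ∈ Γ_F`.
* §2 consequences for a sub-extension `E ≤ F̄` and any such `c`: `forall_smul_eq_iff_mem_galFixing`
  (`σ` fixes `e⁻¹E` iff `c σ ∈ Gal(F̄/E)`), `galFixing_le_range` (if `e(M) ⊆ E` then `Gal(F̄/E) ≤ range c`),
  ★ `apply_mem_of_forall_smul_eq` (Krull–Galois: if `e(M) ⊆ E` and `z ∈ M̄` is fixed by every `σ` with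
  `c σ ∈ Gal(F̄/E)`, then `e z ∈ E` — Mathlib `InfiniteGalois.fixedField_fixingSubgroup` on the `F̄`-side),
  `exists_eq_of_mem_galFixing` (every `g ∈ Gal(F̄/E)` is `c σ` for a `σ` fixing `e⁻¹E`).

## References
* J. S. Milne, *Fields and Galois Theory* (v4.60), Ch. 6 Thm 6.8/Rmk 6.9, Ch. 7 (the absolute Galois group,
  footnote «defined up to an inner automorphism»). [MilneFT2022]
* J. Neukirch, *Algebraic Number Theory* (1999), Ch. IV §1 (infinite Galois theory). [NeukirchANT1999]
-/

noncomputable section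

namespace Literature.NumberTheory.GaloisRepresentations

open Field LocalWeilDatum

section Transport

variable (F M : Type*) [Field F] [Field M] [Algebra F M] [Algebra.IsAlgebraic F M]

/-- **Transport of `Γ_M` into `Γ_F` along an arbitrary `F`-identification `e : M̄ → F̄`.**  There is a group
homomorphism `c : Γ_M →* Γ_F` such that (i) `e (σ • z) = c σ • e z`, (ii) `c` is injective, (iii) `e` is
bijective, (iv) `g ∈ range c ↔ ∀ x : M, g • e(x) = e(x)` (`c = Inn(e ∘ ι) ∘ res`, `ι = absClosureEmbedding F M`).
[cite: MilneFT2022, Ch. 7 (the absolute Galois group; footnote: defined up to an inner automorphism) and Ch. 6 Thm 6.8]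
[cite: NeukirchANT1999, Ch. IV §1] -/
theorem exists_transportHom (e : AlgebraicClosure M →ₐ[F] AlgebraicClosure F) :
    ∃ c : absoluteGaloisGroup M →* absoluteGaloisGroup F,
      (∀ (σ : absoluteGaloisGroup M) (z : AlgebraicClosure M), e (σ • z) = c σ • e z) ∧
      Function.Injective c ∧ Function.Bijective e ∧
      ∀ g : absoluteGaloisGroup F, g ∈ c.range ↔
        ∀ x : M, g • e (algebraMap M (AlgebraicClosure M) x) = e (algebraMap M (AlgebraicClosure M) x) := by
  classical
  -- `g₀ = e ∘ ι` as an `F`-automorphism of `F̄`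
  set ιe := absClosureEquiv F M with hιe
  let f : AlgebraicClosure F →ₐ[F] AlgebraicClosure F := e.comp (ιe : AlgebraicClosure F →ₐ[F] AlgebraicClosure M)
  have hfbij : Function.Bijective f := Algebra.IsAlgebraic.algHom_bijective f
  let τ₀ : AlgebraicClosure F ≃ₐ[F] AlgebraicClosure F := AlgEquiv.ofBijective f hfbij
  let g₀ : absoluteGaloisGroup F := (absoluteGaloisGroup.toAlgEquiv F).symm τ₀
  have hg₀ : ∀ y : AlgebraicClosure F, g₀ • y = e (ιe y) := fun y ↦ rfl
  -- `e z = g₀ • ιe⁻¹ z`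
  have he : ∀ z : AlgebraicClosure M, e z = g₀ • ιe.symm z := fun z ↦ by
    rw [hg₀, AlgEquiv.apply_symm_apply]
  -- `σ • z = ιe (res σ • ιe⁻¹ z)`
  have hres : ∀ (σ : absoluteGaloisGroup M) (z : AlgebraicClosure M),
      σ • z = ιe (absGaloisRestrict F M σ • ιe.symm z) := fun σ z ↦ by
    rw [hιe, absClosureEquiv_apply, absGaloisRestrict_apply_smul, ← absClosureEquiv_apply,
      AlgEquiv.apply_symm_apply]
  refine ⟨(MulAut.conj g₀).toMonoidHom.comp (absGaloisRestrict F M).toMonoidHom, fun σ z ↦ ?_, ?_, ?_, fun g ↦ ?_⟩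
  · -- (i) equivariance
    change e (σ • z) = (g₀ * absGaloisRestrict F M σ * g₀⁻¹) • e z
    rw [he, he, hres σ z, AlgEquiv.symm_apply_apply, mul_smul, mul_smul, inv_smul_smul]
  · -- (ii) injectivity
    exact (MulAut.conj g₀).injective.comp (absGaloisRestrict_injective F M)
  · -- (iii) `e = g₀ ∘ ιe⁻¹` is bijective
    have : (e : AlgebraicClosure M → AlgebraicClosure F) = (fun y ↦ g₀ • y) ∘ ιe.symm := funext he
    rw [this]
    exact (MulAction.bijective g₀).comp ιe.symm.bijective
  · -- (iv) the range
    have hx : ∀ x : M, e (algebraMap M (AlgebraicClosure M) x) = g₀ • absEmbedding F M x := fun x ↦ by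
      rw [hg₀, hιe, absClosureEquiv_apply, absClosureEmbedding_absEmbedding]
    constructor
    · rintro ⟨σ, rfl⟩ x
      change (g₀ * absGaloisRestrict F M σ * g₀⁻¹) • e _ = _
      rw [hx, mul_smul, mul_smul, inv_smul_smul, absGaloisRestrict_smul_absEmbedding]
    · intro hg
      have hmem : g₀⁻¹ * g * g₀ ∈ (absGaloisRestrict F M).range := by
        rw [mem_range_absGaloisRestrict_iff_smul_absEmbedding]
        intro x
        have h := hg x
        rw [hx] at h
        rw [mul_smul, mul_smul, h, inv_smul_smul]
      obtain ⟨σ, hσ⟩ := hmem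
      refine ⟨σ, ?_⟩
      change g₀ * absGaloisRestrict F M σ * g₀⁻¹ = g
      have hσ' : absGaloisRestrict F M σ = g₀⁻¹ * g * g₀ := hσ
      rw [hσ']; group

end Transport

/-! ## §2 Sub-extensions: fixing subgroups and the Krull–Galois step -/

section Fixing

variable {F M : Type*} [Field F] [Field M] [Algebra F M]
  {e : AlgebraicClosure M →ₐ[F] AlgebraicClosure F} {c : absoluteGaloisGroup M →* absoluteGaloisGroup F}
  (hc : ∀ (σ : absoluteGaloisGroup M) (z : AlgebraicClosure M), e (σ • z) = c σ • e z)
  (hbij : Function.Bijective e)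

include hc hbij in
/-- `σ ∈ Γ_M` fixes `e⁻¹E` pointwise iff `c σ ∈ Gal(F̄/E)`. [cite: NeukirchANT1999, Ch. IV §1] -/
theorem forall_smul_eq_iff_mem_galFixing (E : IntermediateField F (AlgebraicClosure F)) (σ : absoluteGaloisGroup M) :
    (∀ z : AlgebraicClosure M, e z ∈ E → σ • z = z) ↔ c σ ∈ galFixing F E := by
  rw [mem_galFixing_iff]
  constructor
  · intro h y hy
    obtain ⟨z, rfl⟩ := hbij.2 y
    rw [← hc, h z hy]
  · intro h z hz
    apply hbij.1
    rw [hc, h _ hz]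

/-- If `e(M) ⊆ E` then `Gal(F̄/E) ≤ range c` (elements fixing `e(M)` come from `Γ_M`), given the range description
of `exists_transportHom` (iv). [cite: MilneFT2022, Ch. 7] -/
theorem galFixing_le_range
    (hrange : ∀ g : absoluteGaloisGroup F, g ∈ c.range ↔
      ∀ x : M, g • e (algebraMap M (AlgebraicClosure M) x) = e (algebraMap M (AlgebraicClosure M) x))
    {E : IntermediateField F (AlgebraicClosure F)}
    (hE : ∀ x : M, e (algebraMap M (AlgebraicClosure M) x) ∈ E) : galFixing F E ≤ c.range := by
  intro g hg
  rw [hrange]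
  exact fun x ↦ (mem_galFixing_iff F).mp hg _ (hE x)

include hc in
/-- ★ **Krull–Galois through the transport**: if `e(M) ⊆ E` (so `Gal(F̄/E) ≤ range c`) and `z ∈ M̄` is fixed by every
`σ ∈ Γ_M` with `c σ ∈ Gal(F̄/E)`, then `e z ∈ E` (`E` is the fixed field of its fixing subgroup in `Gal(F̄/F)`,
Mathlib `InfiniteGalois.fixedField_fixingSubgroup`; `F̄/F` Galois, e.g. `char F = 0`). [cite: NeukirchANT1999, Ch. IV §1 (1.2)]
[cite: MilneFT2022, Ch. 7 (Krull's theorem)] -/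
theorem apply_mem_of_forall_smul_eq [IsGalois F (AlgebraicClosure F)] {E : IntermediateField F (AlgebraicClosure F)}
    (hEc : galFixing F E ≤ c.range) {z : AlgebraicClosure M}
    (hz : ∀ σ : absoluteGaloisGroup M, c σ ∈ galFixing F E → σ • z = z) : e z ∈ E := by
  rw [← InfiniteGalois.fixedField_fixingSubgroup E, IntermediateField.mem_fixedField_iff]
  intro g hg
  -- `g`, an automorphism fixing `E`, read in `Γ_F`
  have hg'mem : (absoluteGaloisGroup.toAlgEquiv F).symm g ∈ galFixing F E :=
    (mem_galFixing_iff F).mpr fun y hy ↦ (IntermediateField.mem_fixingSubgroup_iff E g).mp hg y hy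
  obtain ⟨σ, hσ⟩ := hEc hg'mem
  rw [← absoluteGaloisGroup.toAlgEquiv_symm_apply g (e z), ← hσ, ← hc, hz σ (hσ ▸ hg'mem)]

include hc hbij in
/-- Every `g ∈ Gal(F̄/E)` with `Gal(F̄/E) ≤ range c` is `c σ` for some `σ` fixing `e⁻¹E` pointwise.
[cite: NeukirchANT1999, Ch. IV §1] -/
theorem exists_eq_of_mem_galFixing {E : IntermediateField F (AlgebraicClosure F)} (hEc : galFixing F E ≤ c.range)
    {g : absoluteGaloisGroup F} (hg : g ∈ galFixing F E) :
    ∃ σ : absoluteGaloisGroup M, c σ = g ∧ ∀ z : AlgebraicClosure M, e z ∈ E → σ • z = z := by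
  obtain ⟨σ, rfl⟩ := hEc hg
  exact ⟨σ, rfl, (forall_smul_eq_iff_mem_galFixing hc hbij E σ).mpr hg⟩

end Fixing

end Literature.NumberTheory.GaloisRepresentations

end
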